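import Summits.FinalStateConjecture.FinalStateConjecture.Theorems.RenormalisedDriftDriftCapturePinnedOfSettle
import HarnessLib

/-!
# Crux `DriftCapture` (stmt-FinalStateConjecture-17391), stub `stub_glueForwardChain`:
# near-`η`-isometries of bounded norm are uniformly close to the Lorentz group

The registered stub `stub_glueForwardChain` of the skeleton
`Summits/FinalStateConjecture/FinalStateConjecture/Cruxes/DriftCapture/Lines/registered.lean` glues a
forward chain of approximately flat late charts along their seams. Its seam-rigidity input (G1)
(`Missing.SeamRigidityFlat`) reads: the transition map of two overlapping `ε`-flat charts is
`C²`-close to a Poincaré map. The finite-dimensional core of that fact is proved here: the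
differential `dT(x₀)` of the transition map is a continuous linear self-map `L` of `E4` of bounded
operator norm whose `η`-defect `|η(Lv, Lw) − η(v, w)|` is small, uniformly on the unit ball, and such
an `L` is close IN OPERATOR NORM to SOME Lorentz transformation `Λ ∈ O(1,3)`, with a modulus
depending only on the norm bound:

* `exists_forall_dist_le_of_isCompact_antitone` — the abstract compactness lemma: on a compact set
  `K` of a (pseudo)metric space, if the closed "defect `≤ 1/(n+1)`" sets `A n` decrease and
  `K ∩ ⋂ n, A n ⊆ Z`, then for every `ε > 0` some `A n ∩ K` lies within distance `ε` of `Z`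
  (Bolzano–Weierstrass: a sequence of counterexamples has a limit point in `K ∩ ⋂ n, A n ⊆ Z`);
* `isClosed_setOf_defect_le` — the set of `L : E4 →L[ℝ] E4` with
  `|η(Lv, Lw) − η(v, w)| ≤ δ‖v‖‖w‖` for all `v w` is closed;
* `bilin_eq_of_forall_defect_le` — defect `≤ ‖v‖‖w‖/(n+1)` for every `n` forces `η(Lv, Lw) = η(v, w)`,
  so (`exists_lorentzGroup_coe_eq`, landed in `…PinnedOfSettle`) `L = ↑Λ` for some `Λ ∈ O(1,3)`;
* `exists_lorentzGroup_near_of_small_defect` — the registered sub-goal: for all `Lb` and `ε > 0` there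
  is `δ > 0` such that every `L` with `‖L‖ ≤ Lb` and `η`-defect `≤ δ‖v‖‖w‖` is within `ε` of some
  `↑Λ`, `Λ : lorentzGroup` (the closed ball of radius `Lb` of the finite-dimensional space
  `E4 →L[ℝ] E4` is compact);
* `exists_lorentzGroup_fix_near_of_small_defect` — the time-axis-stabiliser version needed by the
  Kerr seams (G1K): if moreover `‖L ∂₀ − ∂₀‖ ≤ δ`, the Lorentz transformation can be taken with
  `Λ ∂₀ = ∂₀` (the limit of the counterexamples fixes `∂₀` exactly).

No explicit rate is claimed (the true rate is linear in `δ`, by the implicit function theorem at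
`O(1,3)`, but the gluing stub only consumes the qualitative modulus). Mathlib + the landed
`Theorems` file `RenormalisedDriftDriftCapturePinnedOfSettle` only; no definitions, no named facts.

References: O'Neill 1983, Ch. 9, pp. 233–236 (the Lorentz group `O(1,3)` is a closed subgroup of
`GL(E4)` cut out by `η(Λv, Λw) = η(v, w)`).
-/

-- the doubled `FinalStateConjecture.FinalStateConjecture` path component trips dupNamespace
set_option linter.dupNamespace false

noncomputable section

namespace Summit.FinalStateConjecture.FinalStateConjecture.Theorems.RenormalisedDrift.DriftCapture

open Set Filter Topology Metric
open Literature.Geometry.Lorentzian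

/-- **Uniform nearness to the zero set on a compact set (Bolzano–Weierstrass).** Let `K` be a
compact subset of a pseudometric space, `A : ℕ → Set X` a decreasing sequence of closed sets
("defect `≤ 1/(n+1)`") and `Z` a set containing `K ∩ ⋂ n, A n` ("zero defect"). Then for every
`ε > 0` there is an index `n` such that every point of `K ∩ A n` is within distance `ε` of `Z`:
otherwise counterexamples `xₙ ∈ K ∩ A n` have a subsequential limit `y ∈ K`, which lies in every
(closed) `A m`, hence in `Z`, while `dist xₙ y < ε` infinitely often. [folklore] -/
theorem exists_forall_dist_le_of_isCompact_antitone {X : Type*} [PseudoMetricSpace X] {K : Set X}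
    (hK : IsCompact K) {A : ℕ → Set X} (hA : ∀ n, IsClosed (A n)) (hmono : Antitone A)
    {Z : Set X} (hZ : K ∩ ⋂ n, A n ⊆ Z) {ε : ℝ} (hε : 0 < ε) :
    ∃ n, ∀ x ∈ K, x ∈ A n → ∃ z ∈ Z, dist x z ≤ ε := by
  by_contra! H
  choose x hxK hxA hfar using H
  obtain ⟨y, hyK, φ, hφ, hlim⟩ := hK.tendsto_subseq hxK
  have hyA : ∀ m, y ∈ A m := fun m ↦ (hA m).mem_of_tendsto hlim
    (eventually_atTop.2 ⟨m, fun n hn ↦ hmono (hn.trans (hφ.id_le n)) (hxA (φ n))⟩)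
  have hyZ : y ∈ Z := hZ ⟨hyK, mem_iInter.2 hyA⟩
  obtain ⟨n, hn⟩ := ((tendsto_iff_dist_tendsto_zero.1 hlim).eventually_le_const hε).exists
  exact (hfar (φ n) y hyZ).not_ge hn

/-- Evaluation `L ↦ η(Lv, Lw)` is a continuous function of `L : E4 →L[ℝ] E4` for fixed `v w`
(composition of `η` with the continuous linear evaluation maps). [folklore] -/
theorem continuous_bilin_apply_apply (v w : E4) :
    Continuous fun L : E4 →L[ℝ] E4 ↦ Minkowski.bilin (L v) (L w) :=
  (Minkowski.bilin.continuous.comp (ContinuousLinearMap.apply ℝ E4 v).continuous).clm_apply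
    (ContinuousLinearMap.apply ℝ E4 w).continuous

/-- The set of continuous linear self-maps of `E4` whose `η`-defect is at most `δ‖v‖‖w‖`,
`|η(Lv, Lw) − η(v, w)| ≤ δ‖v‖‖w‖` for all `v w`, is closed (an intersection of closed
sublevel sets of continuous functions of `L`). O'Neill 1983, Ch. 9, p. 233 (`δ = 0`: `O(1,3)` is
closed). [folklore] -/
theorem isClosed_setOf_defect_le (δ : ℝ) :
    IsClosed {L : E4 →L[ℝ] E4 |
      ∀ v w : E4, |Minkowski.bilin (L v) (L w) - Minkowski.bilin v w| ≤ δ * ‖v‖ * ‖w‖} := by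
  simp only [setOf_forall]
  exact isClosed_iInter fun v ↦ isClosed_iInter fun w ↦
    isClosed_le ((continuous_bilin_apply_apply v w).sub continuous_const).abs continuous_const

/-- **Zero defect in the limit.** If the `η`-defect of `L` is at most `‖v‖‖w‖/(n+1)` for every
`n : ℕ`, then `L` preserves `η` exactly. [folklore] -/
theorem bilin_eq_of_forall_defect_le (L : E4 →L[ℝ] E4)
    (hL : ∀ n : ℕ, ∀ v w : E4,
      |Minkowski.bilin (L v) (L w) - Minkowski.bilin v w| ≤ ((n : ℝ) + 1)⁻¹ * ‖v‖ * ‖w‖) (v w : E4) :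
    Minkowski.bilin (L v) (L w) = Minkowski.bilin v w := by
  have hlim : Tendsto (fun n : ℕ ↦ ((n : ℝ) + 1)⁻¹ * ‖v‖ * ‖w‖) atTop (𝓝 (0 * ‖v‖ * ‖w‖)) := by
    refine ((tendsto_one_div_add_atTop_nhds_zero_nat (𝕜 := ℝ)).congr fun n ↦ ?_).mul_const _
      |>.mul_const _
    rw [one_div]
  have h0 : |Minkowski.bilin (L v) (L w) - Minkowski.bilin v w| ≤ 0 * ‖v‖ * ‖w‖ :=
    ge_of_tendsto' hlim fun n ↦ hL n v w
  rw [zero_mul, zero_mul, abs_nonpos_iff, sub_eq_zero] at h0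
  exact h0

/-- **Near-`η`-isometries of bounded norm are uniformly close to `O(1,3)`** (the registered
sub-goal `exists_lorentzGroup_near_of_small_defect` of crux `DriftCapture`, the finite-dimensional
core of seam rigidity (G1) for `stub_glueForwardChain`). For every norm bound `Lb` and every `ε > 0`
there is `δ > 0` such that every continuous linear `L : E4 → E4` with `‖L‖ ≤ Lb` and
`|η(Lv, Lw) − η(v, w)| ≤ δ‖v‖‖w‖` for all `v w` is within operator-norm distance `ε` of some
Lorentz transformation. Proof: the closed ball of radius `Lb` in the finite-dimensional space
`E4 →L[ℝ] E4` is compact, the defect sets are closed and decreasing in `δ = 1/(n+1)`, and their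
intersection consists of exact `η`-isometries, which are Lorentz transformations
(`exists_lorentzGroup_coe_eq`); apply `exists_forall_dist_le_of_isCompact_antitone`.
O'Neill 1983, Ch. 9, pp. 233–236. [folklore] -/
theorem exists_lorentzGroup_near_of_small_defect : ∀ (Lb ε : ℝ), 0 < ε → ∃ δ : ℝ, 0 < δ ∧ ∀ L : E4 →L[ℝ] E4, ‖L‖ ≤ Lb → (∀ v w : E4, |Minkowski.bilin (L v) (L w) - Minkowski.bilin v w| ≤ δ * ‖v‖ * ‖w‖) → ∃ Λ : lorentzGroup, ‖L - ((Λ : E4 ≃L[ℝ] E4) : E4 →L[ℝ] E4)‖ ≤ ε := by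
  intro Lb ε hε
  -- the decreasing closed defect sets and the zero-defect set
  set A : ℕ → Set (E4 →L[ℝ] E4) := fun n ↦ {L |
    ∀ v w : E4, |Minkowski.bilin (L v) (L w) - Minkowski.bilin v w| ≤ ((n : ℝ) + 1)⁻¹ * ‖v‖ * ‖w‖}
    with hA
  have hAc : ∀ n, IsClosed (A n) := fun n ↦ isClosed_setOf_defect_le _
  have hmono : Antitone A := by
    intro m n hmn L hL v w
    refine (hL v w).trans (mul_le_mul_of_nonneg_right (mul_le_mul_of_nonneg_right ?_ (norm_nonneg _))
      (norm_nonneg _))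
    exact inv_anti₀ (Nat.cast_add_one_pos m) (by exact_mod_cast Nat.succ_le_succ hmn)
  set Z : Set (E4 →L[ℝ] E4) := range fun Λ : lorentzGroup ↦ ((Λ : E4 ≃L[ℝ] E4) : E4 →L[ℝ] E4)
    with hZ
  have hKZ : closedBall (0 : E4 →L[ℝ] E4) Lb ∩ ⋂ n, A n ⊆ Z := by
    rintro L ⟨-, hL⟩
    obtain ⟨Λ, hΛ⟩ := exists_lorentzGroup_coe_eq L (bilin_eq_of_forall_defect_le L (mem_iInter.1 hL))
    exact ⟨Λ, hΛ⟩
  obtain ⟨n, hn⟩ := exists_forall_dist_le_of_isCompact_antitone (isCompact_closedBall 0 Lb) hAc hmono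
    hKZ hε
  refine ⟨((n : ℝ) + 1)⁻¹, inv_pos.2 (Nat.cast_add_one_pos n), fun L hLb hL ↦ ?_⟩
  obtain ⟨M, ⟨Λ, rfl⟩, hLM⟩ := hn L (mem_closedBall_zero_iff.2 hLb) hL
  exact ⟨Λ, by rwa [← dist_eq_norm]⟩

/-- **Time-axis-stabiliser version (for the Kerr seams (G1K)).** For every norm bound `Lb` and
every `ε > 0` there is `δ > 0` such that every continuous linear `L : E4 → E4` with `‖L‖ ≤ Lb`,
`η`-defect `≤ δ‖v‖‖w‖` AND `‖L ∂₀ − ∂₀‖ ≤ δ` is within operator-norm distance `ε` of a Lorentz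
transformation FIXING `∂₀` (an element of the stabiliser `O(3)` of the time axis). Same proof: the
subsequential limit of counterexamples is an exact `η`-isometry fixing `∂₀` exactly.
O'Neill 1983, Ch. 9, pp. 233–236. [folklore] -/
theorem exists_lorentzGroup_fix_near_of_small_defect : ∀ (Lb ε : ℝ), 0 < ε → ∃ δ : ℝ, 0 < δ ∧ ∀ L : E4 →L[ℝ] E4, ‖L‖ ≤ Lb → (∀ v w : E4, |Minkowski.bilin (L v) (L w) - Minkowski.bilin v w| ≤ δ * ‖v‖ * ‖w‖) → ‖L (E4.basisVector 0) - E4.basisVector 0‖ ≤ δ → ∃ Λ : lorentzGroup, (Λ : E4 ≃L[ℝ] E4) (E4.basisVector 0) = E4.basisVector 0 ∧ ‖L - ((Λ : E4 ≃L[ℝ] E4) : E4 →L[ℝ] E4)‖ ≤ ε := by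
  intro Lb ε hε
  -- the decreasing closed defect-and-displacement sets and the zero set
  set A : ℕ → Set (E4 →L[ℝ] E4) := fun n ↦ {L |
    (∀ v w : E4, |Minkowski.bilin (L v) (L w) - Minkowski.bilin v w| ≤ ((n : ℝ) + 1)⁻¹ * ‖v‖ * ‖w‖) ∧
      ‖L (E4.basisVector 0) - E4.basisVector 0‖ ≤ ((n : ℝ) + 1)⁻¹} with hA
  have hAc : ∀ n, IsClosed (A n) := fun n ↦ by
    simp only [hA, setOf_and]
    exact (isClosed_setOf_defect_le _).inter (isClosed_le
      (((ContinuousLinearMap.apply ℝ E4 (E4.basisVector 0)).continuous.sub continuous_const).norm)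
      continuous_const)
  have hinv : ∀ {m n : ℕ}, m ≤ n → ((n : ℝ) + 1)⁻¹ ≤ ((m : ℝ) + 1)⁻¹ := fun hmn ↦
    inv_anti₀ (Nat.cast_add_one_pos _) (by exact_mod_cast Nat.succ_le_succ hmn)
  have hmono : Antitone A := by
    intro m n hmn L hL
    refine ⟨fun v w ↦ (hL.1 v w).trans (mul_le_mul_of_nonneg_right
      (mul_le_mul_of_nonneg_right (hinv hmn) (norm_nonneg _)) (norm_nonneg _)), hL.2.trans (hinv hmn)⟩
  set Z : Set (E4 →L[ℝ] E4) := {M | ∃ Λ : lorentzGroup,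
    (Λ : E4 ≃L[ℝ] E4) (E4.basisVector 0) = E4.basisVector 0 ∧ ((Λ : E4 ≃L[ℝ] E4) : E4 →L[ℝ] E4) = M}
    with hZ
  have hKZ : closedBall (0 : E4 →L[ℝ] E4) Lb ∩ ⋂ n, A n ⊆ Z := by
    rintro L ⟨-, hL⟩
    rw [mem_iInter] at hL
    obtain ⟨Λ, hΛ⟩ := exists_lorentzGroup_coe_eq L (bilin_eq_of_forall_defect_le L fun n ↦ (hL n).1)
    have h0 : L (E4.basisVector 0) = E4.basisVector 0 := by
      have hlim : Tendsto (fun n : ℕ ↦ ((n : ℝ) + 1)⁻¹) atTop (𝓝 0) :=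
        (tendsto_one_div_add_atTop_nhds_zero_nat (𝕜 := ℝ)).congr fun n ↦ one_div _
      have := ge_of_tendsto' hlim fun n ↦ (hL n).2
      rwa [norm_le_zero_iff, sub_eq_zero] at this
    refine ⟨Λ, ?_, hΛ⟩
    have h1 : (Λ : E4 ≃L[ℝ] E4) (E4.basisVector 0) = L (E4.basisVector 0) := by rw [← hΛ]; rfl
    rw [h1, h0]
  obtain ⟨n, hn⟩ := exists_forall_dist_le_of_isCompact_antitone (isCompact_closedBall 0 Lb) hAc hmono
    hKZ hε
  refine ⟨((n : ℝ) + 1)⁻¹, inv_pos.2 (Nat.cast_add_one_pos n), fun L hLb hL h0 ↦ ?_⟩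
  obtain ⟨M, ⟨Λ, hΛ0, rfl⟩, hLM⟩ := hn L (mem_closedBall_zero_iff.2 hLb) ⟨hL, h0⟩
  exact ⟨Λ, hΛ0, by rwa [← dist_eq_norm]⟩

end Summit.FinalStateConjecture.FinalStateConjecture.Theorems.RenormalisedDrift.DriftCapture

end
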